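import Summits.AtomisticToContinuum.HydrodynamicLimit.Theorems.AprioriBounds.Negative.CriticalMoment
import Summits.AtomisticToContinuum.HydrodynamicLimit.Theorems.AprioriBounds.Negative.FlowInvariance

/-!
# `AprioriBounds` (stmt-AtomisticToContinuum-9519), negative knowledge 7/7: the `∀ λ` strengthening of (i) is false

Load-bearing analysis of the crux `CollisionIsometryCLT.AprioriBounds` by the standing disprover
(`Cruxes/AprioriBounds/Disproof.lean`, refuter-cdisprove-stmt-AtomisticToContinuum-9519-0).

`AprioriBoundsIAllLambdaAt σ a₀ θ₀ u₀` is component (i) of the crux at a given `σ` with the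
exponential parameter made UNIVERSAL (`∀ λ > 0 ∃ C` instead of `∃ λ > 0, C`), everything else
verbatim.  **It is FALSE at equilibrium** (`aprioriBoundsI_allLambda_false_at_equilibrium`:
homogeneous profile at any temperature `θ̄ > 0`, `0 < σ < 1/2`): at `λ = 1/(2θ̄)` the time-averaged
empirical moment exceeds EVERY constant with probability `→ 1`.  Witness flow: the regularised
Alexander flow.  Mechanism: Gibbs invariance (file 6/7) + the Markov–Tonelli bound along the flow
(file 6/7) reduce a small time-integral to a small value at time `0`, whose probability vanishes
because the critical Maxwellian moment is infinite (file 5/7).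

MESSAGE for provers of (i): the existential `λ` is load-bearing and DYNAMICAL — it must be taken
below `1/(2 θ_max(t))`, `θ_max(t)` the largest temperature the gas reaches on `[0, t]`, which
compression and shock heating raise above `max θ₀`; a region held at temperature `≥ 1/(2λ)` for
positive macroscopic time makes the functional of (i) diverge (this is the rigorous kernel of the
post-collapse objection recorded in the Disproof workfile).
-/

noncomputable section

open MeasureTheory ProbabilityTheory Filter Set Topology Metric
open scoped ENNReal

namespace Summit.AtomisticToContinuum.HydrodynamicLimit.Theorems

namespace AprioriBoundsNegative

open Literature.MathematicalPhysics.KineticTheory Literature.Analysis.FluidPDE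

/-! ### The `∀ λ` strengthening of (i) is false at equilibrium -/

/-- The natural strengthening of component (i) of the crux in which the exponential parameter is
UNIVERSAL (`∀ λ > 0 ∃ C`) instead of existential (`∃ λ > 0, C`), at a given `σ` and given profiles
(binder order `(a₀ θ₀ u₀)` as in the crux); everything else verbatim. -/
def AprioriBoundsIAllLambdaAt (σ : ℝ) (a₀ θ₀ : T3 → ℝ) (u₀ : T3 → V3) : Prop :=
  ∀ Φ : (N : ℕ) → HardSphereFlow (Torus.geometry (Fin 3)) (hsDiameter σ N) (N + 1),
    ∀ t : ℝ, 0 < t → ∀ lam : ℝ, 0 < lam → ∃ Cexp : ℝ,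
      Tendsto (fun N : ℕ => localGibbsLaw σ a₀ u₀ θ₀ N (Φ N)
        {z | Cexp < ∫ s in Icc 0 t, ∫ y, Real.exp (lam * ‖y.2‖ ^ 2)
          ∂(empiricalMeasure ((Φ N).flow s z))}) atTop (𝓝 0)

/-- The empirical exponential moment at parameter `1/(2θ̄)` as a function on phase space. -/
theorem integral_exp_empiricalMeasure {N : ℕ} (θb : ℝ) (w : Config (N + 1) (Fin 3) T3) :
    ∫ y, Real.exp (1 / (2 * θb) * ‖y.2‖ ^ 2) ∂(empiricalMeasure w) =
      ((N + 1 : ℕ) : ℝ)⁻¹ * ∑ i, Real.exp (‖(w i).2‖ ^ 2 / (2 * θb)) := by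
  rw [integral_empiricalMeasure]
  simp_rw [one_div_mul_eq_div]

/-- Along any configuration the empirical critical moment is bounded by the (conserved) energy:
`(N+1)⁻¹ ∑ᵢ exp(|vᵢ|²/(2θ̄)) ≤ exp(2E(w)/(2θ̄))`. -/
theorem expAvg_le_exp_energy {N : ℕ} {θb : ℝ} (hθ : 0 < θb) (w : Config (N + 1) (Fin 3) T3) :
    ((N + 1 : ℕ) : ℝ)⁻¹ * ∑ i, Real.exp (‖(w i).2‖ ^ 2 / (2 * θb)) ≤
      Real.exp (2 * configEnergy w / (2 * θb)) := by
  have hterm : ∀ i, Real.exp (‖(w i).2‖ ^ 2 / (2 * θb)) ≤ Real.exp (2 * configEnergy w / (2 * θb)) := by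
    intro i
    refine Real.exp_le_exp.2 (div_le_div_of_nonneg_right ?_ (by positivity))
    unfold configEnergy
    rw [← mul_assoc, mul_inv_cancel₀ (two_ne_zero), one_mul]
    exact Finset.single_le_sum (f := fun j => ‖(w j).2‖ ^ 2) (fun j _ => by positivity)
      (Finset.mem_univ i)
  calc ((N + 1 : ℕ) : ℝ)⁻¹ * ∑ i, Real.exp (‖(w i).2‖ ^ 2 / (2 * θb))
      ≤ ((N + 1 : ℕ) : ℝ)⁻¹ * ∑ _i : Fin (N + 1), Real.exp (2 * configEnergy w / (2 * θb)) :=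
        mul_le_mul_of_nonneg_left (Finset.sum_le_sum fun i _ => hterm i) (by positivity)
    _ = Real.exp (2 * configEnergy w / (2 * θb)) := by
        rw [Finset.sum_const, Finset.card_univ, Fintype.card_fin, nsmul_eq_mul, ← mul_assoc,
          inv_mul_cancel₀ (by positivity), one_mul]

/-- **The `∀ λ` strengthening of (i) is false at equilibrium** (`0 < σ < 1/2`, homogeneous profile
at any temperature `θ̄ > 0`): at `λ = 1/(2θ̄)` the time-averaged empirical exponential moment
exceeds EVERY constant with probability `→ 1`.  Witness flow: the regularised Alexander flow
(`Alexander.regHardSphereFlow`: a genuine `HardSphereFlow`, jointly measurable, energy-conserving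
everywhere).  Mechanism: the homogeneous local Gibbs law is flow-invariant
(`measurePreserving_regFlow_localGibbsMeasure`), the critical one-particle moment is infinite so
`P_N{(N+1)⁻¹∑ exp(|vᵢ|²/2θ̄) ≤ a} → 0` for every `a` (`tendsto_localGibbsMeasure_expAvg_le`), and
a small time-integral forces small values for half the time, which is as rare as a small value at
time `0` (`measure_setIntegral_orbit_le`).  MESSAGE for provers of (i): `λ` must be chosen below
`1/(2 θ_max)` with `θ_max` the largest temperature the gas reaches on `[0, t]` — a dynamical
quantity raised by compression and shock heating. -/
theorem aprioriBoundsI_allLambda_false_at_equilibrium {σ θb : ℝ} (hσ : 0 < σ) (hσ2 : σ < 1 / 2)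
    (hθ : 0 < θb) :
    ¬ AprioriBoundsIAllLambdaAt σ (fun _ => 1) (fun _ => θb) (fun _ => 0) := by
  intro h
  set Φ : (N : ℕ) → HardSphereFlow (Torus.geometry (Fin 3)) (hsDiameter σ N) (N + 1) :=
    fun N => Alexander.regHardSphereFlow (d := Fin 3) (hsDiameter_pos hσ N)
      ((hsDiameter_le hσ.le N).trans_lt (by linarith)) (N + 1) with hΦ
  have hlam : (0 : ℝ) < 1 / (2 * θb) := by positivity
  obtain ⟨Cexp, hT⟩ := h Φ 1 one_pos (1 / (2 * θb)) hlam
  -- the empirical critical moment as a phase-space function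
  set F : (N : ℕ) → Config (N + 1) (Fin 3) T3 → ℝ :=
    fun N z => ((N + 1 : ℕ) : ℝ)⁻¹ * ∑ i, Real.exp (‖(z i).2‖ ^ 2 / (2 * θb)) with hF
  have hFm : ∀ N, Measurable (F N) := fun N =>
    measurable_const.mul (Finset.measurable_sum _ fun i _ => by fun_prop)
  have hF0 : ∀ N z, 0 ≤ F N z := fun N z =>
    mul_nonneg (by positivity) (Finset.sum_nonneg fun i _ => (Real.exp_pos _).le)
  set a : ℝ := 2 * (max Cexp 0 + 1) with ha
  have ha0 : 0 < a := by rw [ha]; positivity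
  have hMa : Cexp ≤ a * 1 / 2 := by
    rw [ha]; linarith [le_max_left Cexp 0]
  -- the bad event of the strengthening is small only if its complement is large; bound the
  -- complement by twice the lower tail of the critical moment
  have hcompl : ∀ N, localGibbsLaw σ (fun _ => 1) (fun _ => 0) (fun _ => θb) N (Φ N)
      {z | ∫ s in Icc 0 1, ∫ y, Real.exp (1 / (2 * θb) * ‖y.2‖ ^ 2)
        ∂(empiricalMeasure ((Φ N).flow s z)) ≤ Cexp} ≤
      2 * localGibbsMeasure σ (fun _ => 1) (fun _ => 0) (fun _ => θb) N {z | F N z ≤ a} := by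
    intro N
    rw [localGibbsLaw_eq]
    haveI := isProbabilityMeasure_localGibbsMeasure (u₀ := fun _ => (0 : V3)) continuous_const
      continuous_const continuous_const (fun _ => one_pos) (fun _ => hθ) hσ2.le N
    have hev : {z : Config (N + 1) (Fin 3) T3 | ∫ s in Icc 0 1, ∫ y, Real.exp (1 / (2 * θb) * ‖y.2‖ ^ 2)
        ∂(empiricalMeasure ((Φ N).flow s z)) ≤ Cexp} =
        {z | ∫ s in Icc 0 1, F N ((Φ N).flow s z) ≤ Cexp} := by
      ext z
      simp only [mem_setOf_eq, hF, integral_exp_empiricalMeasure]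
    rw [hev]
    have hflow : (Φ N).flow = Alexander.regFlow (Torus.geometry (Fin 3)) (hsDiameter σ N) := rfl
    refine measure_setIntegral_orbit_le (localGibbsMeasure σ (fun _ => 1) (fun _ => 0) (fun _ => θb) N)
      (T := (Φ N).flow) ?_ ?_ (hFm N) (hF0 N) ?_ one_pos ha0 hMa
    · rw [hflow]; exact Alexander.measurable_regFlow_uncurry ((hsDiameter_le hσ.le N).trans_lt (by linarith))
    · intro s; rw [hflow]; exact measurePreserving_regFlow_localGibbsMeasure hσ hσ2 θb N s
    · intro z
      refine ⟨Real.exp (2 * configEnergy z / (2 * θb)), fun s => ?_⟩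
      rw [hflow]
      have := expAvg_le_exp_energy (N := N) hθ (Alexander.regFlow (Torus.geometry (Fin 3)) (hsDiameter σ N) s z)
      rwa [Alexander.configEnergy_regFlow] at this
  -- both the event and its complement would have vanishing probability
  have htail : Tendsto (fun N : ℕ => 2 * localGibbsMeasure σ (fun _ => 1) (fun _ => 0) (fun _ => θb) N
      {z | F N z ≤ a}) atTop (𝓝 0) := by
    have h0 := tendsto_localGibbsMeasure_expAvg_le hσ2.le hθ a
    have := ENNReal.Tendsto.const_mul h0 (Or.inr (by norm_num : (2 : ℝ≥0∞) ≠ ⊤))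
    rw [mul_zero] at this
    exact this
  have hhalf : (0 : ℝ≥0∞) < 2⁻¹ := by norm_num
  have h1 := hT.eventually (gt_mem_nhds hhalf)
  have h2 := htail.eventually (gt_mem_nhds hhalf)
  obtain ⟨N, hN1, hN2⟩ := (h1.and h2).exists
  have huniv : localGibbsLaw σ (fun _ => 1) (fun _ => 0) (fun _ => θb) N (Φ N) univ = 1 := by
    haveI := isProbabilityMeasure_localGibbsLaw (u₀ := fun _ => (0 : V3)) continuous_const
      continuous_const continuous_const (fun _ => one_pos) (fun _ => hθ) hσ2.le N (Φ N)
    exact measure_univ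
  have hcover : (univ : Set (Config (N + 1) (Fin 3) T3)) ⊆
      {z | Cexp < ∫ s in Icc 0 1, ∫ y, Real.exp (1 / (2 * θb) * ‖y.2‖ ^ 2)
        ∂(empiricalMeasure ((Φ N).flow s z))} ∪
      {z | ∫ s in Icc 0 1, ∫ y, Real.exp (1 / (2 * θb) * ‖y.2‖ ^ 2)
        ∂(empiricalMeasure ((Φ N).flow s z)) ≤ Cexp} := by
    intro z _
    simp only [mem_union, mem_setOf_eq]
    exact lt_or_ge _ _
  have hsum := (measure_mono (μ := localGibbsLaw σ (fun _ => 1) (fun _ => 0) (fun _ => θb) N (Φ N))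
    hcover).trans (measure_union_le _ _)
  rw [huniv] at hsum
  have hlt : localGibbsLaw σ (fun _ => 1) (fun _ => 0) (fun _ => θb) N (Φ N)
      {z | Cexp < ∫ s in Icc 0 1, ∫ y, Real.exp (1 / (2 * θb) * ‖y.2‖ ^ 2)
        ∂(empiricalMeasure ((Φ N).flow s z))} +
      localGibbsLaw σ (fun _ => 1) (fun _ => 0) (fun _ => θb) N (Φ N)
      {z | ∫ s in Icc 0 1, ∫ y, Real.exp (1 / (2 * θb) * ‖y.2‖ ^ 2)
        ∂(empiricalMeasure ((Φ N).flow s z)) ≤ Cexp} < 2⁻¹ + 2⁻¹ :=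
    ENNReal.add_lt_add hN1 (lt_of_le_of_lt (hcompl N) hN2)
  rw [ENNReal.inv_two_add_inv_two] at hlt
  exact absurd (lt_of_le_of_lt hsum hlt) (lt_irrefl 1)

end AprioriBoundsNegative

end Summit.AtomisticToContinuum.HydrodynamicLimit.Theorems

end
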